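import Summits.HodgeConjecture.HodgeConjecture.Theorems.K2E3WittParabolicBlocksLift      -- ★ (K2E3-p10): entries of `wittFormOn`, `exists_unitary_coe_eq`, `wittFormOn_mul_wittFormOn`
import Summits.HodgeConjecture.HodgeConjecture.Theorems.K2E3WittLeviConeCentreKernel      -- ★ (K2E3-p10): `rev_apply_inr_inl'` (rev permutes the kernel slots, any `m`)
import Literature.NumberTheory.Automorphic.HyperspecialUnitarySatakeIsomorphism            -- ★ `swapPairs`, `flipPair`
import Literature.NumberTheory.Automorphic.HyperspecialUnitaryCartanUnique                 -- ★ `permGL`, `v_permMatrix_apply_le_one`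
import Literature.NumberTheory.Automorphic.BorelBruhatCellsGK                              -- ★ `permGL_mul_mul_permGL_apply`
import HarnessLib

/-!
# Frame tools for the Witt form `W = wittFormOn e Han` with an ARBITRARY anisotropic kernel (crux H413, U12-g ∕ 13a road A, hand (T2) — the `m = 2`,
# wildly ramified places): frame slots, `h(e_p, ·)`, the entries of `g⁻¹` for `g ∈ U(σ, W)`, valuation bounds, kernel-fixing Weyl permutations

Cell `hodgecm-mathlib`, Track B «K2-LIT», line `K2_E3_EllipticInputs`, 13a road A (line lead K2E3-p10 (g3), RULINGS #13); seat K2E3-p09 (g3).  THEOREMS ONLY;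
`--supports stmt-HodgeConjecture-24833 --as helper`.

For a standard indexing `e : WittIndex r m ≃ Fin N` (`hstd`) the FRAME slots are the `e_i = e (inl i)` and the `f`-slots `e (inr (inr j))`; the KERNEL slots are the
`e (inr (inl u))`.  We phrase «`p` is a frame slot» as `∀ u, p ≠ e (inr (inl u))`.  This file is the kernel-agnostic part of ★ p856626 §1 (`K2E3QuasiSplitUnitaryCartanAnyInvolutionStep`,
which is the case `W = J₀`): everything the bounded (compact-SET currency) Cartan decomposition of `U(σ, W)` needs about the frame, for ANY `Han` (no integrality, no
maximality, no `m ≤ 1`).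

* §1 frame slots: `wittFormOn_apply_of_frame` (row `p` of `W` is the unit vector at `rev p`), its column version, `rev` of a frame slot is a frame slot ≠ itself,
  the value criterion `frame_iff`.
* §2 `hermForm_single_frame_left ∕ right`: `h(e_p, v) = v_{rev p}`, `h(v, e_p) = σ(v_{rev p})` for a frame slot `p`.
* §3 the inverse of `g ∈ U(σ, W)`: `g⁻¹ = W(Han⁻¹) σ(g)ᵀ W`; on frame × frame slots `(g⁻¹)_{ij} = σ(g_{rev j, rev i})`; the kernel part of a frame row of `g` is `Han`
  applied to the kernel part of a frame column of `g⁻¹` (`kernel_row_eq`); valuation bounds for products and inverses (`v_mul_apply_le`, `v_inv_apply_le`).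
* §4 Weyl permutations: a permutation of `Fin N` commuting with `rev` and FIXING the kernel slots has its matrix in `U(σ, W)` (`permGL_mem_unitaryGroupOfForm_witt`);
  for every frame slot `s` there is one with `τ 0 = s` (`exists_perm_frame`).

HONEST LABEL: tools; HC_CM is proved only modulo the 7 printed citations (2 remaining named inputs: hLiu418 = stmt-HodgeConjecture-24832, h413 = stmt-HodgeConjecture-24833)
until rung 0 closes.

References: J. Dieudonné, *La géométrie des groupes classiques* (1971), Chap. I §11, Chap. II §5; F. Bruhat, J. Tits, *Groupes réductifs sur un corps local I* (1972),
(4.4.3); A. Borel, *Linear Algebraic Groups* (1991), §23.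
-/

set_option autoImplicit false
-- the mandated namespace repeats `HodgeConjecture.HodgeConjecture`, as in every `Theorems/*.lean` of this sub-problem
set_option linter.dupNamespace false

noncomputable section

open scoped Valued WithZero Matrix MatrixGroups
open Matrix

namespace Summit.HodgeConjecture.HodgeConjecture.Cruxes.H413.K2E3WittFrameTools

open Literature.NumberTheory.Automorphic Literature.NumberTheory.Automorphic.UnitaryGroup Literature.NumberTheory.Automorphic.HermitianLattice
open K2E3LocalUnitaryWitt K2E3WittCartanUnramified K2E3WittParabolicBlocks K2E3WittParabolicBlocksLift K2E3WittLeviConeCentreKernel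

/-! ## §1 Frame slots -/

section Frame

variable {R : Type*} [CommRing R] {N r m : ℕ} (e : WittIndex r m ≃ Fin N)
  (hstd : ∀ x, (e x).val = Sum.elim (fun i : Fin r => i.val) (Sum.elim (fun u : Fin m => r + u.val) (fun j : Fin r => r + m + j.val)) x)
  (Han : Matrix (Fin m) (Fin m) R)

include hstd in
/-- **Row `p` of the Witt form at a frame slot is the unit vector at `rev p`.** [cite: Dieudonne1971GroupesClassiques, Chap. I §11] -/
theorem wittFormOn_apply_of_frame {p : Fin N} (hp : ∀ u : Fin m, p ≠ e (Sum.inr (Sum.inl u))) (q : Fin N) :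
    wittFormOn e Han p q = if q = Fin.rev p then 1 else 0 := by
  obtain ⟨x, rfl⟩ := e.surjective p
  rcases x with i | u | j
  · exact wittFormOn_apply_inl e hstd Han i q
  · exact absurd rfl (hp u)
  · exact wittFormOn_apply_inr_inr e hstd Han j q

include hstd in
/-- **Column `q` of the Witt form at a frame slot is the unit vector at `rev q`.** [cite: Dieudonne1971GroupesClassiques, Chap. I §11] -/
theorem wittFormOn_apply_of_frame' {q : Fin N} (hq : ∀ u : Fin m, q ≠ e (Sum.inr (Sum.inl u))) (p : Fin N) :
    wittFormOn e Han p q = if p = Fin.rev q then 1 else 0 := by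
  obtain ⟨x, rfl⟩ := e.surjective q
  rcases x with i | u | j
  · rw [wittFormOn_apply_comm_inl, wittFormOn_apply_inl e hstd Han]
  · exact absurd rfl (hq u)
  · rw [wittFormOn_apply_comm_inr_inr, wittFormOn_apply_inr_inr e hstd Han]

/-- Row of a kernel slot against a frame slot vanishes. [cite: Dieudonne1971GroupesClassiques, Chap. I §11] -/
theorem wittFormOn_kernel_frame (u : Fin m) {q : Fin N} (hq : ∀ u' : Fin m, q ≠ e (Sum.inr (Sum.inl u'))) :
    wittFormOn e Han (e (Sum.inr (Sum.inl u))) q = 0 := by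
  rw [wittFormOn_apply_inr_inl]
  obtain ⟨x, rfl⟩ := e.surjective q
  rw [e.symm_apply_apply]
  rcases x with i | u' | j
  · rfl
  · exact absurd rfl (hq u')
  · rfl

/-- Row of a kernel slot against a kernel slot is the kernel entry. [cite: Dieudonne1971GroupesClassiques, Chap. I §11] -/
theorem wittFormOn_kernel_kernel (u u' : Fin m) : wittFormOn e Han (e (Sum.inr (Sum.inl u))) (e (Sum.inr (Sum.inl u'))) = Han u u' := by
  rw [wittFormOn_apply_inr_inl, e.symm_apply_apply]; rfl

include hstd in
/-- **`rev` of a frame slot is a frame slot.** [cite: Borel1991, §23] -/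
theorem frame_rev {p : Fin N} (hp : ∀ u : Fin m, p ≠ e (Sum.inr (Sum.inl u))) : ∀ u : Fin m, Fin.rev p ≠ e (Sum.inr (Sum.inl u)) := by
  intro u h
  apply hp (Fin.rev u)
  rw [← Fin.rev_rev p, h, rev_apply_inr_inl' e hstd]

include hstd in
/-- A frame slot is not `rev`-fixed. [cite: Borel1991, §23] -/
theorem ne_rev_of_frame {p : Fin N} (hp : ∀ u : Fin m, p ≠ e (Sum.inr (Sum.inl u))) : p ≠ Fin.rev p := by
  obtain ⟨x, rfl⟩ := e.surjective p
  rcases x with i | u | j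
  · rw [rev_apply_inl e hstd]; exact fun h => Sum.inl_ne_inr (e.injective h)
  · exact absurd rfl (hp u)
  · rw [rev_apply_inr_inr e hstd]; exact fun h => Sum.inr_ne_inl (e.injective h)

include hstd in
/-- **Value criterion**: `p` is a frame slot iff `p < r` or `r + m ≤ p`. [cite: Borel1991, §23] -/
theorem frame_iff (p : Fin N) : (∀ u : Fin m, p ≠ e (Sum.inr (Sum.inl u))) ↔ ((p : ℕ) < r ∨ r + m ≤ (p : ℕ)) := by
  constructor
  · intro hp
    obtain ⟨x, rfl⟩ := e.surjective p
    rcases x with i | u | j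
    · left; rw [hstd]; exact i.isLt
    · exact absurd rfl (hp u)
    · right; rw [hstd]; simp
  · rintro h u rfl
    rw [hstd] at h
    simp only [Sum.elim_inr, Sum.elim_inl] at h
    have := u.isLt
    omega

include hstd in
/-- The values of the kernel slots: `r ≤ e(u) < r + m`. [cite: Borel1991, §23] -/
theorem kernel_val (u : Fin m) : r ≤ ((e (Sum.inr (Sum.inl u)) : Fin N) : ℕ) ∧ ((e (Sum.inr (Sum.inl u)) : Fin N) : ℕ) < r + m := by
  rw [hstd]; simp only [Sum.elim_inr, Sum.elim_inl]; have := u.isLt; omega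

end Frame

/-! ## §2 `h(e_p, ·)` and `h(·, e_p)` at a frame slot -/

section Pairing

variable {R : Type*} [CommRing R] (σ : R →+* R) {N r m : ℕ} (e : WittIndex r m ≃ Fin N)
  (hstd : ∀ x, (e x).val = Sum.elim (fun i : Fin r => i.val) (Sum.elim (fun u : Fin m => r + u.val) (fun j : Fin r => r + m + j.val)) x)
  (Han : Matrix (Fin m) (Fin m) R)

/-- `(g e_t)_i = g_{it}`. [folklore] -/
theorem mulVec_single_one (g : Matrix (Fin N) (Fin N) R) (t : Fin N) : g *ᵥ Pi.single t 1 = fun i => g i t := by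
  ext i; simp [Matrix.mulVec, dotProduct, Pi.single_apply]

include hstd in
/-- **`h(e_p, v) = v_{rev p}`** at a frame slot `p`. [cite: Dieudonne1971GroupesClassiques, Chap. I §11] -/
theorem hermForm_single_frame_left {p : Fin N} (hp : ∀ u : Fin m, p ≠ e (Sum.inr (Sum.inl u))) (v : Fin N → R) :
    hermForm σ (wittFormOn e Han) (Pi.single p 1) v = v (Fin.rev p) := by
  rw [hermForm_apply, dotProduct]
  rw [Finset.sum_eq_single p]
  · rw [Function.comp_apply, Pi.single_eq_same, map_one, one_mul, Matrix.mulVec, dotProduct]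
    rw [Finset.sum_eq_single (Fin.rev p)]
    · rw [wittFormOn_apply_of_frame e hstd Han hp, if_pos rfl, one_mul]
    · intro q _ hq; rw [wittFormOn_apply_of_frame e hstd Han hp, if_neg hq, zero_mul]
    · exact fun h => absurd (Finset.mem_univ _) h
  · intro i _ hi; rw [Function.comp_apply, Pi.single_eq_of_ne hi, map_zero, zero_mul]
  · exact fun h => absurd (Finset.mem_univ _) h

include hstd in
/-- **`h(v, e_p) = σ(v_{rev p})`** at a frame slot `p`. [cite: Dieudonne1971GroupesClassiques, Chap. I §11] -/
theorem hermForm_single_frame_right {p : Fin N} (hp : ∀ u : Fin m, p ≠ e (Sum.inr (Sum.inl u))) (v : Fin N → R) :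
    hermForm σ (wittFormOn e Han) v (Pi.single p 1) = σ (v (Fin.rev p)) := by
  rw [hermForm_apply, mulVec_single_one, dotProduct, Finset.sum_eq_single (Fin.rev p)]
  · dsimp only [Function.comp_apply]
    rw [wittFormOn_apply_of_frame' e hstd Han hp, if_pos rfl, mul_one]
  · intro i _ hi; dsimp only [Function.comp_apply]; rw [wittFormOn_apply_of_frame' e hstd Han hp, if_neg hi, mul_zero]
  · exact fun h => absurd (Finset.mem_univ _) h

include hstd in
/-- `h(e_p, e_q) = [q = rev p]` for a frame slot `p`. [cite: Dieudonne1971GroupesClassiques, Chap. I §11] -/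
theorem hermForm_single_single_frame {p : Fin N} (hp : ∀ u : Fin m, p ≠ e (Sum.inr (Sum.inl u))) (q : Fin N) :
    hermForm σ (wittFormOn e Han) (Pi.single p 1) (Pi.single q 1) = if q = Fin.rev p then 1 else 0 := by
  rw [hermForm_single_frame_left σ e hstd Han hp, Pi.single_apply]
  exact if_congr eq_comm rfl rfl

end Pairing

/-! ## §3 The inverse of an element of `U(σ, W)` and valuation bounds -/

section Inverse

variable {K : Type*} [Field K] (σ : K →+* K) {N r m : ℕ} (e : WittIndex r m ≃ Fin N)
  (hstd : ∀ x, (e x).val = Sum.elim (fun i : Fin r => i.val) (Sum.elim (fun u : Fin m => r + u.val) (fun j : Fin r => r + m + j.val)) x)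
  (Han : Matrix (Fin m) (Fin m) K)

/-- **`g⁻¹ = W(Han⁻¹) · σ(g)ᵀ · W` for `g ∈ U(σ, W)`** (`det Han` a unit). [cite: Rogawski1990, §1.9 p. 13] -/
theorem coe_inv_eq (hHan : IsUnit Han.det) (g : unitaryGroupOfForm σ (wittFormOn e Han)) :
    (((g⁻¹ : unitaryGroupOfForm σ (wittFormOn e Han)) : GL (Fin N) K) : Matrix (Fin N) (Fin N) K) =
      wittFormOn e Han⁻¹ * (((g : GL (Fin N) K) : Matrix (Fin N) (Fin N) K).map σ)ᵀ * wittFormOn e Han := by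
  have hg := mem_unitaryGroupOfForm_iff.1 g.2
  have hinv : Han⁻¹ * Han = 1 := Matrix.nonsing_inv_mul Han hHan
  have h2 : wittFormOn e Han⁻¹ * (((g : GL (Fin N) K) : Matrix (Fin N) (Fin N) K).map σ)ᵀ * wittFormOn e Han * ((g : GL (Fin N) K) : Matrix (Fin N) (Fin N) K) = 1 := by
    rw [Matrix.mul_assoc, Matrix.mul_assoc, ← Matrix.mul_assoc ((((g : GL (Fin N) K) : Matrix (Fin N) (Fin N) K).map σ)ᵀ), hg, wittFormOn_mul_wittFormOn e hinv]
  rw [Subgroup.coe_inv, Matrix.coe_units_inv]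
  exact (Matrix.inv_eq_left_inv h2)

include hstd in
/-- **`(g⁻¹)_{ij} = σ(g_{rev j, rev i})` on frame × frame slots.** [cite: Rogawski1990, §1.9] [cite: Dieudonne1971GroupesClassiques, Chap. II §5] -/
theorem inv_apply_frame_frame (hHan : IsUnit Han.det) (g : unitaryGroupOfForm σ (wittFormOn e Han)) {i j : Fin N}
    (hi : ∀ u : Fin m, i ≠ e (Sum.inr (Sum.inl u))) (hj : ∀ u : Fin m, j ≠ e (Sum.inr (Sum.inl u))) :
    (((g⁻¹ : unitaryGroupOfForm σ (wittFormOn e Han)) : GL (Fin N) K) : Matrix (Fin N) (Fin N) K) i j =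
      σ (((g : GL (Fin N) K) : Matrix (Fin N) (Fin N) K) (Fin.rev j) (Fin.rev i)) := by
  rw [coe_inv_eq σ e Han hHan, Matrix.mul_apply, Finset.sum_eq_single (Fin.rev j)]
  · rw [wittFormOn_apply_of_frame' e hstd Han hj, if_pos rfl, mul_one, Matrix.mul_apply, Finset.sum_eq_single (Fin.rev i)]
    · rw [wittFormOn_apply_of_frame e hstd Han⁻¹ hi, if_pos rfl, one_mul, Matrix.transpose_apply, Matrix.map_apply]
    · intro k _ hk; rw [wittFormOn_apply_of_frame e hstd Han⁻¹ hi, if_neg hk, zero_mul]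
    · exact fun h => absurd (Finset.mem_univ _) h
  · intro l _ hl; rw [wittFormOn_apply_of_frame' e hstd Han hj, if_neg hl, mul_zero]
  · exact fun h => absurd (Finset.mem_univ _) h

include hstd in
/-- **The kernel part of a frame ROW of `g` is `Han` of the kernel part of a frame COLUMN of `g⁻¹`**: `σ(g_{p, u}) = Σ_{u′} Han_{u u′} (g⁻¹)_{u′, rev p}`
(from `σ(g)ᵀ W = W g⁻¹`). [cite: Rogawski1990, §1.9] -/
theorem kernel_row_eq (g : unitaryGroupOfForm σ (wittFormOn e Han)) {p : Fin N} (hp : ∀ u : Fin m, p ≠ e (Sum.inr (Sum.inl u))) (u : Fin m) :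
    σ (((g : GL (Fin N) K) : Matrix (Fin N) (Fin N) K) p (e (Sum.inr (Sum.inl u)))) =
      ∑ u' : Fin m, Han u u' * (((g⁻¹ : unitaryGroupOfForm σ (wittFormOn e Han)) : GL (Fin N) K) : Matrix (Fin N) (Fin N) K) (e (Sum.inr (Sum.inl u'))) (Fin.rev p) := by
  set A : Matrix (Fin N) (Fin N) K := ((g : GL (Fin N) K) : Matrix (Fin N) (Fin N) K) with hA
  have hg : (A.map σ)ᵀ * wittFormOn e Han * A = wittFormOn e Han := mem_unitaryGroupOfForm_iff.1 g.2
  have hAi : A * (((g⁻¹ : unitaryGroupOfForm σ (wittFormOn e Han)) : GL (Fin N) K) : Matrix (Fin N) (Fin N) K) = 1 := by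
    rw [hA, Subgroup.coe_inv, ← Units.val_mul, mul_inv_cancel, Units.val_one]
  have key : (A.map σ)ᵀ * wittFormOn e Han = wittFormOn e Han * (((g⁻¹ : unitaryGroupOfForm σ (wittFormOn e Han)) : GL (Fin N) K) : Matrix (Fin N) (Fin N) K) := by
    calc (A.map σ)ᵀ * wittFormOn e Han = (A.map σ)ᵀ * wittFormOn e Han * (A * (((g⁻¹ : unitaryGroupOfForm σ (wittFormOn e Han)) : GL (Fin N) K) : Matrix (Fin N) (Fin N) K)) := by
          rw [hAi, Matrix.mul_one]
      _ = wittFormOn e Han * (((g⁻¹ : unitaryGroupOfForm σ (wittFormOn e Han)) : GL (Fin N) K) : Matrix (Fin N) (Fin N) K) := by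
          rw [← Matrix.mul_assoc, hg]
  have h := congrFun (congrFun key (e (Sum.inr (Sum.inl u)))) (Fin.rev p)
  rw [Matrix.mul_apply, Matrix.mul_apply, Finset.sum_eq_single p] at h
  · rw [Matrix.transpose_apply, Matrix.map_apply, wittFormOn_apply_of_frame' e hstd Han (frame_rev e hstd hp) p, if_pos (Fin.rev_rev p).symm, mul_one] at h
    rw [h]
    -- the sum over `Fin N` reduces to the kernel slots
    rw [← Equiv.sum_comp e, ← Finset.sum_subset (Finset.subset_univ (Finset.univ.image (fun u' : Fin m => (Sum.inr (Sum.inl u') : WittIndex r m))))]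
    · rw [Finset.sum_image (fun a _ b _ h => by simpa using h)]
      exact Finset.sum_congr rfl fun u' _ => by rw [wittFormOn_kernel_kernel]
    · intro x _ hx
      rcases x with i | u' | j
      · rw [wittFormOn_apply_inr_inl, e.symm_apply_apply]; exact zero_mul _
      · exact absurd (Finset.mem_image.2 ⟨u', Finset.mem_univ _, rfl⟩) hx
      · rw [wittFormOn_apply_inr_inl, e.symm_apply_apply]; exact zero_mul _
  · intro l _ hl
    rw [wittFormOn_apply_of_frame' e hstd Han (frame_rev e hstd hp) l, Fin.rev_rev, if_neg hl, mul_zero]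
  · exact fun h' => absurd (Finset.mem_univ _) h'

variable [Valued K ℤᵐ⁰]

/-- **Products of bounded matrices are bounded**: entries of `A B` are bounded by the product of the bounds (ultrametric). [folklore] -/
theorem v_mul_apply_le {n : Type*} [Fintype n] {A B : Matrix n n K} {a b : ℤᵐ⁰} (hA : ∀ i j, Valued.v (A i j) ≤ a) (hB : ∀ i j, Valued.v (B i j) ≤ b)
    (i j : n) : Valued.v ((A * B) i j) ≤ a * b := by
  rw [Matrix.mul_apply]
  refine Valued.v.map_sum_le fun k _ => ?_
  rw [map_mul]; exact mul_le_mul' (hA i k) (hB k j)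

/-- Entries of `σ(A)ᵀ` are bounded like those of `A` (`σ` isometric). [folklore] -/
theorem v_transpose_map_apply_le (hvσ : ∀ x, Valued.v (σ x) = Valued.v x) {A : Matrix (Fin N) (Fin N) K} {a : ℤᵐ⁰} (hA : ∀ i j, Valued.v (A i j) ≤ a)
    (i j : Fin N) : Valued.v ((A.map σ)ᵀ i j) ≤ a := by
  rw [Matrix.transpose_apply, Matrix.map_apply, hvσ]; exact hA j i

/-- **The inverse of a bounded element of `U(σ, W)` is bounded**: `v((g⁻¹)_{ij}) ≤ B · M · B` if the entries of `g` are bounded by `M` and those of `W`,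
`W(Han⁻¹)` by `B`. [cite: Rogawski1990, §1.9] -/
theorem v_inv_apply_le (hvσ : ∀ x, Valued.v (σ x) = Valued.v x) (hHan : IsUnit Han.det) (g : unitaryGroupOfForm σ (wittFormOn e Han)) {B M : ℤᵐ⁰}
    (hW : ∀ p q, Valued.v (wittFormOn e Han p q) ≤ B) (hWi : ∀ p q, Valued.v (wittFormOn e Han⁻¹ p q) ≤ B)
    (hg : ∀ p q, Valued.v (((g : GL (Fin N) K) : Matrix (Fin N) (Fin N) K) p q) ≤ M) (i j : Fin N) :
    Valued.v ((((g⁻¹ : unitaryGroupOfForm σ (wittFormOn e Han)) : GL (Fin N) K) : Matrix (Fin N) (Fin N) K) i j) ≤ B * M * B := by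
  rw [coe_inv_eq σ e Han hHan]
  exact v_mul_apply_le (v_mul_apply_le hWi (v_transpose_map_apply_le σ hvσ hg)) hW i j

include hstd in
/-- **Frame-row kernel entries of `g` are controlled by the kernel part of a frame column of `g⁻¹`**: `v(g_{p,u}) ≤ B · X` if `v(Han) ≤ B` and the kernel part of
column `rev p` of `g⁻¹` is bounded by `X`. [cite: Rogawski1990, §1.9] -/
theorem v_kernel_entry_le (hvσ : ∀ x, Valued.v (σ x) = Valued.v x) (g : unitaryGroupOfForm σ (wittFormOn e Han)) {p : Fin N}
    (hp : ∀ u : Fin m, p ≠ e (Sum.inr (Sum.inl u))) {B X : ℤᵐ⁰} (hHanB : ∀ u u', Valued.v (Han u u') ≤ B)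
    (hX : ∀ u', Valued.v ((((g⁻¹ : unitaryGroupOfForm σ (wittFormOn e Han)) : GL (Fin N) K) : Matrix (Fin N) (Fin N) K) (e (Sum.inr (Sum.inl u'))) (Fin.rev p)) ≤ X)
    (u : Fin m) : Valued.v (((g : GL (Fin N) K) : Matrix (Fin N) (Fin N) K) p (e (Sum.inr (Sum.inl u)))) ≤ B * X := by
  rw [← hvσ, kernel_row_eq σ e hstd Han g hp u]
  refine Valued.v.map_sum_le fun u' _ => ?_
  rw [map_mul]; exact mul_le_mul' (hHanB u u') (hX u')

end Inverse

/-! ## §4 Kernel-fixing Weyl permutations -/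

section Weyl

variable {K : Type*} [Field K] (σ : K →+* K) {N r m : ℕ} (e : WittIndex r m ≃ Fin N)
  (hstd : ∀ x, (e x).val = Sum.elim (fun i : Fin r => i.val) (Sum.elim (fun u : Fin m => r + u.val) (fun j : Fin r => r + m + j.val)) x)
  (Han : Matrix (Fin m) (Fin m) K)

include hstd in
/-- **A permutation commuting with `rev` and fixing the kernel slots preserves the Witt form**: `W (τ a) (τ b) = W a b`. [cite: BruhatTits1972, (4.4.3)] -/
theorem wittFormOn_perm (τ : Equiv.Perm (Fin N)) (hτ : ∀ i, τ (Fin.rev i) = Fin.rev (τ i)) (hτk : ∀ u : Fin m, τ (e (Sum.inr (Sum.inl u))) = e (Sum.inr (Sum.inl u)))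
    (a b : Fin N) : wittFormOn e Han (τ a) (τ b) = wittFormOn e Han a b := by
  have hframe : ∀ {p : Fin N}, (∀ u : Fin m, p ≠ e (Sum.inr (Sum.inl u))) → ∀ u : Fin m, τ p ≠ e (Sum.inr (Sum.inl u)) := by
    intro p hp u h
    exact hp u (τ.injective (h.trans (hτk u).symm))
  by_cases ha : ∀ u : Fin m, a ≠ e (Sum.inr (Sum.inl u))
  · rw [wittFormOn_apply_of_frame e hstd Han (hframe ha), wittFormOn_apply_of_frame e hstd Han ha]
    exact if_congr (by rw [← hτ]; exact τ.injective.eq_iff) rfl rfl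
  · push Not at ha
    obtain ⟨u, rfl⟩ := ha
    rw [hτk]
    by_cases hb : ∀ u' : Fin m, b ≠ e (Sum.inr (Sum.inl u'))
    · rw [wittFormOn_kernel_frame e Han u (hframe hb), wittFormOn_kernel_frame e Han u hb]
    · push Not at hb
      obtain ⟨u', rfl⟩ := hb
      rw [hτk]

/-- `σ` fixes a permutation matrix. [folklore] -/
theorem permMatrix_map (τ : Equiv.Perm (Fin N)) : (τ.permMatrix K).map σ = τ.permMatrix K := by
  ext i j
  rw [Matrix.map_apply, permMatrix_apply']
  split_ifs
  · rw [map_one]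
  · rw [map_zero]

include hstd in
/-- **`P_τ ∈ U(σ, W)`** for `τ` commuting with `rev` and fixing the kernel slots (the relative Weyl group representatives of `U(σ, W)`).
[cite: BruhatTits1972, (4.4.3)] [cite: Tits1979, §3.3.3] -/
theorem permGL_mem_unitaryGroupOfForm_witt (τ : Equiv.Perm (Fin N)) (hτ : ∀ i, τ (Fin.rev i) = Fin.rev (τ i))
    (hτk : ∀ u : Fin m, τ (e (Sum.inr (Sum.inl u))) = e (Sum.inr (Sum.inl u))) :
    (permGL τ : GL (Fin N) K) ∈ unitaryGroupOfForm σ (wittFormOn e Han) := by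
  rw [mem_unitaryGroupOfForm_iff]
  have ht : (((permGL τ : GL (Fin N) K) : Matrix (Fin N) (Fin N) K).map σ)ᵀ = ((permGL τ⁻¹ : GL (Fin N) K) : Matrix (Fin N) (Fin N) K) := by
    rw [coe_permGL, coe_permGL, permMatrix_map, Matrix.transpose_permMatrix]
  rw [ht]
  ext i j
  rw [permGL_mul_mul_permGL_apply]
  have h := wittFormOn_perm e hstd Han τ hτ hτk (τ⁻¹ i) (τ.symm j)
  rw [show τ (τ⁻¹ i) = i from τ.apply_symm_apply i, τ.apply_symm_apply] at h
  exact h.symm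

/-- Entries of a permutation matrix are integral. [folklore] -/
theorem v_permGL_apply_le_one [Valued K ℤᵐ⁰] (τ : Equiv.Perm (Fin N)) (i j : Fin N) : Valued.v (((permGL τ : GL (Fin N) K) : Matrix (Fin N) (Fin N) K) i j) ≤ 1 := by
  rw [coe_permGL]; exact CartanUnique.v_permMatrix_apply_le_one τ i j

include hstd in
/-- **For every frame slot `s` there is a kernel-fixing, `rev`-commuting permutation with `τ 0 = s`** (a pair swap ★ `swapPairs`, a flip ★ `flipPair`, or their
composite — they move only the four frame slots `0, rev 0, s, rev s`). [cite: BruhatTits1972, (4.4.3)] [cite: Tits1979, §3.3.3] -/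
theorem exists_perm_frame (hr : 1 ≤ r) {s : Fin N} (hs : ∀ u : Fin m, s ≠ e (Sum.inr (Sum.inl u))) :
    ∃ τ : Equiv.Perm (Fin N), (∀ i, τ (Fin.rev i) = Fin.rev (τ i)) ∧ (∀ u : Fin m, τ (e (Sum.inr (Sum.inl u))) = e (Sum.inr (Sum.inl u))) ∧
      τ ⟨0, by have := (Fintype.card_congr e).symm; simp at this; omega⟩ = s := by
  have hN : N = r + (m + r) := by simpa using (Fintype.card_congr e).symm
  have hsv := (frame_iff e hstd s).1 hs
  have hkv : ∀ u : Fin m, r ≤ ((e (Sum.inr (Sum.inl u)) : Fin N) : ℕ) ∧ ((e (Sum.inr (Sum.inl u)) : Fin N) : ℕ) < r + m := kernel_val e hstd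
  set z : Fin N := ⟨0, by omega⟩ with hz
  have h0 : ((z : Fin N) : ℕ) < N / 2 := by change 0 < N / 2; omega
  have hsrev : (s : ℕ) ≠ N - 1 - (s : ℕ) := fun h => ne_rev_of_frame e hstd hs (Fin.ext (by rw [Fin.val_rev]; omega))
  -- kernel slots are fixed by the flip of the pair `(0, N-1)` and by pair swaps among frame slots below `N/2`
  have hflipk : ∀ u : Fin m, flipPair z (e (Sum.inr (Sum.inl u))) = e (Sum.inr (Sum.inl u)) := fun u => by
    have := hkv u
    refine flipPair_apply_of_ne (fun h => ?_) (fun h => ?_)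
    · have h' := congrArg Fin.val h; change _ = 0 at h'; omega
    · have h' := congrArg Fin.val h; rw [Fin.val_rev] at h'; change _ = N - (0 + 1) at h'; omega
  have hswapk : ∀ {t : Fin N}, (∀ u : Fin m, t ≠ e (Sum.inr (Sum.inl u))) → z ≠ t → (ht : (t : ℕ) < N / 2) → ∀ u : Fin m,
      swapPairs z t (e (Sum.inr (Sum.inl u))) = e (Sum.inr (Sum.inl u)) := by
    intro t htf hzt ht u
    have htv := (frame_iff e hstd t).1 htf
    have := hkv u
    apply Fin.ext
    rw [swapPairs_val hzt h0 ht]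
    change (if _ = N - 1 - 0 then N - 1 - (t : ℕ) else _) = _
    have h1 : ((e (Sum.inr (Sum.inl u)) : Fin N) : ℕ) ≠ N - 1 - 0 := by omega
    have h2 : ((e (Sum.inr (Sum.inl u)) : Fin N) : ℕ) ≠ N - 1 - (t : ℕ) := by omega
    have h3 : ((e (Sum.inr (Sum.inl u)) : Fin N) : ℕ) ≠ ((z : Fin N) : ℕ) := by change _ ≠ 0; omega
    have h4 : ((e (Sum.inr (Sum.inl u)) : Fin N) : ℕ) ≠ (t : ℕ) := by omega
    rw [if_neg h1, if_neg h2, if_neg h3, if_neg h4]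
  by_cases hlow : (s : ℕ) < N / 2
  · by_cases h0s : z = s
    · exact ⟨1, fun i => rfl, fun u => rfl, h0s⟩
    · exact ⟨swapPairs z s, fun i => swapPairs_rev h0s h0 hlow i, hswapk hs h0s hlow, swapPairs_apply_left h0s h0 hlow⟩
  · have hrev : ((Fin.rev s : Fin N) : ℕ) < N / 2 := by rw [Fin.val_rev]; have := s.isLt; omega
    by_cases h0s : z = Fin.rev s
    · refine ⟨flipPair z, fun i => flipPair_rev _ i, hflipk, ?_⟩
      rw [flipPair_apply_self, h0s, Fin.rev_rev]
    · refine ⟨swapPairs z (Fin.rev s) * flipPair z, fun i => ?_, fun u => ?_, ?_⟩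
      · rw [Equiv.Perm.mul_apply, Equiv.Perm.mul_apply, flipPair_rev, swapPairs_rev h0s h0 hrev]
      · rw [Equiv.Perm.mul_apply, hflipk, hswapk (frame_rev e hstd hs) h0s hrev]
      · rw [Equiv.Perm.mul_apply, flipPair_apply_self, swapPairs_rev h0s h0 hrev, swapPairs_apply_left h0s h0 hrev, Fin.rev_rev]

/-- The inverse of a kernel-fixing permutation fixes the kernel. [folklore] -/
theorem perm_inv_kernel {τ : Equiv.Perm (Fin N)} (hτk : ∀ u : Fin m, τ (e (Sum.inr (Sum.inl u))) = e (Sum.inr (Sum.inl u))) (u : Fin m) :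
    τ⁻¹ (e (Sum.inr (Sum.inl u))) = e (Sum.inr (Sum.inl u)) := by
  apply τ.injective
  rw [Equiv.Perm.inv_def, Equiv.apply_symm_apply, hτk]

include hstd in
/-- A kernel-fixing permutation maps frame slots to frame slots. [folklore] -/
theorem perm_frame {τ : Equiv.Perm (Fin N)} (hτk : ∀ u : Fin m, τ (e (Sum.inr (Sum.inl u))) = e (Sum.inr (Sum.inl u))) {p : Fin N}
    (hp : ∀ u : Fin m, p ≠ e (Sum.inr (Sum.inl u))) : ∀ u : Fin m, τ p ≠ e (Sum.inr (Sum.inl u)) := by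
  have _ := hstd
  intro u h
  exact hp u (τ.injective (h.trans (hτk u).symm))

end Weyl

end Summit.HodgeConjecture.HodgeConjecture.Cruxes.H413.K2E3WittFrameTools

end
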